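import Mathlib
import HarnessLib
import Literature.Probability.MarkovChains.ProductChains

/-!
# Product chains, I: tensorisation of the Poincaré inequality over two factors and the splitting
# `Π_{j≤d} X_j ≃ X_0 × Π_{j<d} X_{j+1}` of `π̃` and `𝓔̃` (the mechanism behind Levin–Peres–Wilmer Cor. 12.13,
# `γ̃ = min_j w_jγ_j`)

HONEST FRAMING: exact (Metropolis-corrected) sampling algorithms for lattice gauge theory; figures
of merit are autocorrelation/cost numbers at stated couplings and volumes; no continuum-physics claim.

Conventions of `ProductChains.lean` (`coordKernel`, `prodKernel w P = P̃` (12.22), `tensorFun π = π̃`),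
`PeskunOrdering.lean` (`dirichletForm π P f = 𝓔(f)`), `DistinguishingStatistic.lean` (`lawMean`, `lawVariance`).
Source: D. A. Levin, Y. Peres (with E. L. Wilmer), *Markov Chains and Mixing Times*, 2nd ed., AMS 2017
[LevinPeres2017], §12.4 (product chains, eqs. (12.22)–(12.23), Corollary 12.13 `γ̃ = min_j w_jγ_j`).
`ProductChains.lean` proves `γ̃ ≤ min_j w_jγ_j`; the companion file `ProductChainSpectralGap.lean` proves
`≥` from the lemmas here.  Everything is PROVED (finite sums; 0 named facts).

DECLARED DEVIATION (proof route).  The book obtains Cor. 12.13 from the completeness of the tensor eigenbasis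
(Lemma 12.12 (ii)).  Here the lower bound is prepared in POINCARÉ FORM by tensorisation of the variance (the
Efron–Stein mechanism): for a product law `π_A ⊗ π_B`, `Var(F) = E_B[Var_A F(·,b)] + Var_B(E_A F)` and
`Var_B(E_A F) ≤ E_A[Var_B F(a,·)]`, while the Dirichlet form of a two-factor product chain splits as
`E_B[𝓔_A] + E_A[𝓔_B]`; so a common Poincaré constant of the factors is one for the product (`poincare_pair`).

* `meanSq_eq_lawVariance_add_sq`, `sq_lawMean_le`; `lawVariance_pair_eq` (total variance), `lawVariance_mean_le`
  (convexity); **`poincare_pair`**; `pairKernel Q_A Q_B` (eq. (12.22) for two factors, weights absorbed) and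
  `dirichletForm_pairKernel`;
* `tensorFun_cons`, `sum_pi_cons`, `lawVariance_tensorFun_cons`, `prodKernel_cons_cons`,
  `dirichletForm_prodKernel_eq_pair`, **`dirichletForm_prodKernel_cons`** — splitting off coordinate `0`:
  `𝓔̃(f) = Σ_{x'} π̃'(x')𝓔_{π_0}(w_0P_0; f(·,x')) + Σ_{x_0} π_0(x_0)𝓔_{π̃'}(P̃'; f(x_0,·))`.

Context (cell pub-lqcd, venture LatticeQCDFlow): the tensorisation step that decomposition bounds for
replica-exchange samplers need (the within-tag dynamics is a product over the replicas), and the converse of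
the volume law of `ProductChains.lean`.
-/

namespace Literature.Probability.MarkovChains

open Finset Matrix Function

universe u

/-! ## Two elementary variance facts -/

section Elementary

variable {Y : Type*} [Fintype Y]

/-- The mean square about a constant splits into the variance and the squared bias:
`Σ_x μ(x)(f(x) − c)² = Var_μ(f) + (E_μ f − c)²` (`Σ μ = 1`). [cite: LevinPeres2017, §12.4 Cor. 12.13
(tensorisation route; elementary step)] -/
theorem meanSq_eq_lawVariance_add_sq {μ : Y → ℝ} (hμ1 : ∑ x, μ x = 1) (f : Y → ℝ) (c : ℝ) :
    ∑ x, μ x * (f x - c) ^ 2 = lawVariance μ f + (lawMean μ f - c) ^ 2 := by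
  unfold lawVariance lawMean
  set m := ∑ x, μ x * f x with hm
  have e : ∀ x, μ x * (f x - c) ^ 2 = μ x * (f x - m) ^ 2 + 2 * (m - c) * (μ x * f x - m * μ x)
      + (m - c) ^ 2 * μ x := fun x => by ring
  simp_rw [e, Finset.sum_add_distrib, ← Finset.mul_sum, Finset.sum_sub_distrib, ← Finset.mul_sum, ← hm, hμ1]
  ring

/-- Jensen for the square: `(E_μ g)² ≤ E_μ(g²)` for a probability vector `μ ≥ 0`.
[cite: LevinPeres2017, §12.4 Cor. 12.13 (tensorisation route; elementary step)] -/
theorem sq_lawMean_le {μ : Y → ℝ} (hμ0 : ∀ x, 0 ≤ μ x) (hμ1 : ∑ x, μ x = 1) (g : Y → ℝ) :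
    (∑ x, μ x * g x) ^ 2 ≤ ∑ x, μ x * g x ^ 2 := by
  have hv := lawVariance_nonneg hμ0 g
  unfold lawVariance lawMean at hv
  set m := ∑ x, μ x * g x with hm
  have e : ∀ x, μ x * (g x - m) ^ 2 = μ x * g x ^ 2 - 2 * m * (μ x * g x) + m ^ 2 * μ x :=
    fun x => by ring
  simp_rw [e, Finset.sum_add_distrib, Finset.sum_sub_distrib, ← Finset.mul_sum, ← hm, hμ1] at hv
  nlinarith

end Elementary

/-! ## Two factors: tensorisation of the Poincaré inequality -/

section Pair

variable {A B : Type*} [Fintype A] [Fintype B]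

/-- **Total variance on a product law**:
`Var_{π_A⊗π_B}(F) = Σ_b π_B(b)·Var_{π_A}F(·,b) + Var_{π_B}(b ↦ E_{π_A}F(·,b))`.
[cite: LevinPeres2017, §12.4 Cor. 12.13 (tensorisation route; elementary step)] -/
theorem lawVariance_pair_eq {πA : A → ℝ} (hA1 : ∑ a, πA a = 1) (πB : B → ℝ) (F : A → B → ℝ) :
    lawVariance (fun p : A × B => πA p.1 * πB p.2) (fun p => F p.1 p.2)
      = ∑ b, πB b * lawVariance πA (fun a => F a b)
        + lawVariance πB (fun b => lawMean πA (fun a => F a b)) := by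
  have hmean : lawMean (fun p : A × B => πA p.1 * πB p.2) (fun p => F p.1 p.2)
      = lawMean πB (fun b => lawMean πA (fun a => F a b)) := by
    unfold lawMean
    rw [Fintype.sum_prod_type, Finset.sum_comm]
    refine sum_congr rfl fun b _ => ?_
    rw [Finset.mul_sum]
    exact sum_congr rfl fun a _ => by ring
  set m := lawMean πB (fun b => lawMean πA (fun a => F a b)) with hm
  have hL : lawVariance (fun p : A × B => πA p.1 * πB p.2) (fun p => F p.1 p.2)
      = ∑ b, ∑ a, πA a * πB b * (F a b - m) ^ 2 := by
    unfold lawVariance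
    rw [hmean, Fintype.sum_prod_type, Finset.sum_comm]
  rw [hL]
  unfold lawVariance
  rw [← hm, ← Finset.sum_add_distrib]
  refine sum_congr rfl fun b _ => ?_
  set M := lawMean πA (fun a => F a b) with hM
  have hM' : ∑ a, πA a * F a b = M := rfl
  have e : ∀ a, πA a * πB b * (F a b - m) ^ 2
      = πB b * (πA a * (F a b - M) ^ 2) + πB b * (2 * (M - m)) * (πA a * F a b - M * πA a)
        + πB b * (M - m) ^ 2 * πA a := fun a => by ring
  simp_rw [e]
  rw [Finset.sum_add_distrib, Finset.sum_add_distrib, ← Finset.mul_sum, ← Finset.mul_sum, ← Finset.mul_sum,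
    Finset.sum_sub_distrib, ← Finset.mul_sum, hM', hA1]
  ring

/-- **Convexity of the variance**: `Var_{π_B}(b ↦ E_{π_A}F(·,b)) ≤ Σ_a π_A(a)·Var_{π_B}F(a,·)`.
[cite: LevinPeres2017, §12.4 Cor. 12.13 (tensorisation route; elementary step)] -/
theorem lawVariance_mean_le {πA : A → ℝ} {πB : B → ℝ} (hA0 : ∀ a, 0 ≤ πA a) (hA1 : ∑ a, πA a = 1)
    (hB0 : ∀ b, 0 ≤ πB b) (hB1 : ∑ b, πB b = 1) (F : A → B → ℝ) :
    lawVariance πB (fun b => lawMean πA (fun a => F a b))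
      ≤ ∑ a, πA a * lawVariance πB (fun b => F a b) := by
  set mB : A → ℝ := fun a => lawMean πB (fun b => F a b) with hmB
  have hle : lawVariance πB (fun b => lawMean πA (fun a => F a b))
      ≤ ∑ b, πB b * (lawMean πA (fun a => F a b) - ∑ a, πA a * mB a) ^ 2 := by
    rw [meanSq_eq_lawVariance_add_sq hB1]
    nlinarith [sq_nonneg (lawMean πB (fun b => lawMean πA (fun a => F a b)) - ∑ a, πA a * mB a)]
  refine hle.trans ?_
  -- Jensen at fixed `b`
  have hJ : ∀ b, (lawMean πA (fun a => F a b) - ∑ a, πA a * mB a) ^ 2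
      ≤ ∑ a, πA a * (F a b - mB a) ^ 2 := by
    intro b
    have hdiff : lawMean πA (fun a => F a b) - ∑ a, πA a * mB a = ∑ a, πA a * (F a b - mB a) := by
      unfold lawMean
      rw [← Finset.sum_sub_distrib]
      exact sum_congr rfl fun a _ => by ring
    rw [hdiff]
    exact sq_lawMean_le hA0 hA1 _
  calc ∑ b, πB b * (lawMean πA (fun a => F a b) - ∑ a, πA a * mB a) ^ 2
      ≤ ∑ b, πB b * ∑ a, πA a * (F a b - mB a) ^ 2 :=
        sum_le_sum fun b _ => mul_le_mul_of_nonneg_left (hJ b) (hB0 b)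
    _ = ∑ a, πA a * lawVariance πB (fun b => F a b) := by
        unfold lawVariance
        simp_rw [Finset.mul_sum]
        rw [Finset.sum_comm]
        exact sum_congr rfl fun a _ => sum_congr rfl fun b _ => by rw [hmB]; ring

/-- **TENSORISATION, TWO FACTORS.**  If `c·Var_{π_A}(h) ≤ 𝓔_{π_A}(Q_A; h)` and `c·Var_{π_B}(g) ≤ 𝓔_{π_B}(Q_B; g)`
for all `h`, `g` (probability vectors `π_A, π_B ≥ 0`, kernels `Q_A, Q_B ≥ 0`), then for every `F`,
`c·Var_{π_A⊗π_B}(F) ≤ Σ_b π_B(b)𝓔_{π_A}(Q_A; F(·,b)) + Σ_a π_A(a)𝓔_{π_B}(Q_B; F(a,·))`.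
[cite: LevinPeres2017, §12.4 Cor. 12.13 (tensorisation route)] -/
theorem poincare_pair {πA : A → ℝ} {πB : B → ℝ} (hA0 : ∀ a, 0 ≤ πA a) (hA1 : ∑ a, πA a = 1)
    (hB0 : ∀ b, 0 ≤ πB b) (hB1 : ∑ b, πB b = 1) {QA : Matrix A A ℝ} {QB : Matrix B B ℝ}
    (hQA : ∀ a a', 0 ≤ QA a a') (hQB : ∀ b b', 0 ≤ QB b b') {c : ℝ}
    (hA : ∀ h : A → ℝ, c * lawVariance πA h ≤ dirichletForm πA QA h)
    (hB : ∀ g : B → ℝ, c * lawVariance πB g ≤ dirichletForm πB QB g) (F : A → B → ℝ) :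
    c * lawVariance (fun p : A × B => πA p.1 * πB p.2) (fun p => F p.1 p.2)
      ≤ ∑ b, πB b * dirichletForm πA QA (fun a => F a b) + ∑ a, πA a * dirichletForm πB QB (fun b => F a b) := by
  have hRA : 0 ≤ ∑ b, πB b * dirichletForm πA QA (fun a => F a b) :=
    sum_nonneg fun b _ => mul_nonneg (hB0 b) (dirichletForm_nonneg hA0 hQA _)
  have hRB : 0 ≤ ∑ a, πA a * dirichletForm πB QB (fun b => F a b) :=
    sum_nonneg fun a _ => mul_nonneg (hA0 a) (dirichletForm_nonneg hB0 hQB _)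
  by_cases hc : c ≤ 0
  · have hV := lawVariance_nonneg (fun p : A × B => mul_nonneg (hA0 p.1) (hB0 p.2)) (fun p => F p.1 p.2)
    nlinarith
  push Not at hc
  rw [lawVariance_pair_eq hA1 πB, mul_add]
  refine add_le_add ?_ ?_
  · rw [Finset.mul_sum]
    refine sum_le_sum fun b _ => ?_
    rw [mul_left_comm]
    exact mul_le_mul_of_nonneg_left (hA _) (hB0 b)
  · calc c * lawVariance πB (fun b => lawMean πA (fun a => F a b))
        ≤ c * ∑ a, πA a * lawVariance πB (fun b => F a b) :=
          mul_le_mul_of_nonneg_left (lawVariance_mean_le hA0 hA1 hB0 hB1 F) hc.le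
      _ = ∑ a, πA a * (c * lawVariance πB (fun b => F a b)) := by
          rw [Finset.mul_sum]
          exact sum_congr rfl fun a _ => by ring
      _ ≤ ∑ a, πA a * dirichletForm πB QB (fun b => F a b) :=
          sum_le_sum fun a _ => mul_le_mul_of_nonneg_left (hB _) (hA0 a)

variable [DecidableEq A] [DecidableEq B]

/-- The two-factor product chain with the weights absorbed: move the first coordinate with `Q_A` or the second
with `Q_B` (eq. (12.22) for `d = 2`, `Q_A = w_1P_1`, `Q_B = w_2P_2`). [cite: LevinPeres2017, §12.4
eq. (12.22)] -/
def pairKernel (QA : Matrix A A ℝ) (QB : Matrix B B ℝ) : Matrix (A × B) (A × B) ℝ :=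
  fun p q => (if q.2 = p.2 then QA p.1 q.1 else 0) + (if q.1 = p.1 then QB p.2 q.2 else 0)

/-- **The Dirichlet form of the two-factor product chain splits:**
`𝓔_{π_A⊗π_B}(pairKernel Q_A Q_B; F) = Σ_b π_B(b)𝓔_{π_A}(Q_A; F(·,b)) + Σ_a π_A(a)𝓔_{π_B}(Q_B; F(a,·))`.
[cite: LevinPeres2017, §12.4 eqs. (12.22)–(12.23) ("`P̃ = Σ_j w_j P̃_j`")] -/
theorem dirichletForm_pairKernel (πA : A → ℝ) (πB : B → ℝ) (QA : Matrix A A ℝ) (QB : Matrix B B ℝ)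
    (F : A → B → ℝ) :
    dirichletForm (fun p : A × B => πA p.1 * πB p.2) (pairKernel QA QB) (fun p => F p.1 p.2)
      = ∑ b, πB b * dirichletForm πA QA (fun a => F a b) + ∑ a, πA a * dirichletForm πB QB (fun b => F a b) := by
  -- moves of the first coordinate: the sum over `b₂` collapses to `b₂ = b`
  have H1 : ∑ p : A × B, ∑ q : A × B,
      πA p.1 * πB p.2 * (if q.2 = p.2 then QA p.1 q.1 else 0) * (F p.1 p.2 - F q.1 q.2) ^ 2
        = ∑ b, πB b * ∑ a, ∑ a₂, πA a * QA a a₂ * (F a b - F a₂ b) ^ 2 := by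
    calc ∑ p : A × B, ∑ q : A × B,
          πA p.1 * πB p.2 * (if q.2 = p.2 then QA p.1 q.1 else 0) * (F p.1 p.2 - F q.1 q.2) ^ 2
        = ∑ a, ∑ b, ∑ a₂, ∑ b₂, (if b₂ = b then πA a * πB b * QA a a₂ * (F a b - F a₂ b₂) ^ 2 else 0) := by
          rw [Fintype.sum_prod_type]
          refine sum_congr rfl fun a _ => sum_congr rfl fun b _ => ?_
          rw [Fintype.sum_prod_type]
          refine sum_congr rfl fun a₂ _ => sum_congr rfl fun b₂ _ => ?_
          split_ifs <;> ring
      _ = ∑ a, ∑ b, ∑ a₂, πA a * πB b * QA a a₂ * (F a b - F a₂ b) ^ 2 := by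
          refine sum_congr rfl fun a _ => sum_congr rfl fun b _ => sum_congr rfl fun a₂ _ => ?_
          rw [Finset.sum_ite_eq' univ b, if_pos (mem_univ _)]
      _ = ∑ b, πB b * ∑ a, ∑ a₂, πA a * QA a a₂ * (F a b - F a₂ b) ^ 2 := by
          rw [Finset.sum_comm]
          refine sum_congr rfl fun b _ => ?_
          rw [Finset.mul_sum]
          refine sum_congr rfl fun a _ => ?_
          rw [Finset.mul_sum]
          exact sum_congr rfl fun a₂ _ => by ring
  -- moves of the second coordinate: the sum over `a₂` collapses to `a₂ = a`
  have H2 : ∑ p : A × B, ∑ q : A × B,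
      πA p.1 * πB p.2 * (if q.1 = p.1 then QB p.2 q.2 else 0) * (F p.1 p.2 - F q.1 q.2) ^ 2
        = ∑ a, πA a * ∑ b, ∑ b₂, πB b * QB b b₂ * (F a b - F a b₂) ^ 2 := by
    calc ∑ p : A × B, ∑ q : A × B,
          πA p.1 * πB p.2 * (if q.1 = p.1 then QB p.2 q.2 else 0) * (F p.1 p.2 - F q.1 q.2) ^ 2
        = ∑ a, ∑ b, ∑ b₂, ∑ a₂, (if a₂ = a then πA a * πB b * QB b b₂ * (F a b - F a₂ b₂) ^ 2 else 0) := by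
          rw [Fintype.sum_prod_type]
          refine sum_congr rfl fun a _ => sum_congr rfl fun b _ => ?_
          rw [Fintype.sum_prod_type, Finset.sum_comm]
          refine sum_congr rfl fun b₂ _ => sum_congr rfl fun a₂ _ => ?_
          split_ifs <;> ring
      _ = ∑ a, ∑ b, ∑ b₂, πA a * πB b * QB b b₂ * (F a b - F a b₂) ^ 2 := by
          refine sum_congr rfl fun a _ => sum_congr rfl fun b _ => sum_congr rfl fun b₂ _ => ?_
          rw [Finset.sum_ite_eq' univ a, if_pos (mem_univ _)]
      _ = ∑ a, πA a * ∑ b, ∑ b₂, πB b * QB b b₂ * (F a b - F a b₂) ^ 2 := by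
          refine sum_congr rfl fun a _ => ?_
          rw [Finset.mul_sum]
          refine sum_congr rfl fun b _ => ?_
          rw [Finset.mul_sum]
          exact sum_congr rfl fun b₂ _ => by ring
  unfold dirichletForm pairKernel
  simp_rw [mul_add, add_mul, Finset.sum_add_distrib]
  rw [mul_add, H1, H2, Finset.mul_sum, Finset.mul_sum]
  congr 1
  · exact sum_congr rfl fun b _ => by ring
  · exact sum_congr rfl fun a _ => by ring

end Pair

/-! ## Splitting off coordinate `0` of a product over `Fin (d+1)` -/

section Cons

variable {d : ℕ} {X : Fin (d + 1) → Type u} [∀ j, Fintype (X j)] [∀ j, DecidableEq (X j)]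

omit [∀ j, Fintype (X j)] [∀ j, DecidableEq (X j)] in
/-- `π̃(x_0, x') = π_0(x_0)·π̃'(x')`. [cite: LevinPeres2017, §12.4 (definition of `π_1 ⊗ ⋯ ⊗ π_d`)] -/
theorem tensorFun_cons (φ : ∀ j, X j → ℝ) (u : X 0) (y : ∀ i : Fin d, X i.succ) :
    tensorFun φ (Fin.cons u y) = φ 0 u * tensorFun (fun i : Fin d => φ i.succ) y := by
  unfold tensorFun
  rw [Fin.prod_univ_succ]
  simp only [Fin.cons_zero, Fin.cons_succ]

omit [∀ j, DecidableEq (X j)] in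
/-- Summing over `Π_{j ≤ d} X_j` is summing over `x_0` and over the tail. [cite: LevinPeres2017, §12.4
(the product state space)] -/
theorem sum_pi_cons (G : (∀ j, X j) → ℝ) :
    ∑ x, G x = ∑ u : X 0, ∑ y : (∀ i : Fin d, X i.succ), G (Fin.cons u y) := by
  rw [← (Fin.consEquiv X).sum_comp, Fintype.sum_prod_type]
  rfl

omit [∀ j, DecidableEq (X j)] in
/-- The variance under `π̃` is the variance under the pair law `π_0 ⊗ π̃'` of the function read through
`Fin.cons`. [cite: LevinPeres2017, §12.4 Cor. 12.13 (tensorisation route)] -/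
theorem lawVariance_tensorFun_cons (π : ∀ j, X j → ℝ) (f : (∀ j, X j) → ℝ) :
    lawVariance (tensorFun π) f
      = lawVariance (fun p : X 0 × (∀ i : Fin d, X i.succ) => π 0 p.1 * tensorFun (fun i : Fin d => π i.succ) p.2)
          (fun p => f (Fin.cons p.1 p.2)) := by
  unfold lawVariance lawMean
  rw [sum_pi_cons, sum_pi_cons, Fintype.sum_prod_type, Fintype.sum_prod_type]
  simp_rw [tensorFun_cons]

/-- A kernel multiplied by a constant multiplies the Dirichlet form. [cite: LevinPeres2017, §13.2.1
(definition of `𝓔`, eq. (13.2))] -/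
theorem dirichletForm_const_mul_kernel {Y : Type*} [Fintype Y] (μ : Y → ℝ) (Q : Matrix Y Y ℝ) (s : ℝ)
    (h : Y → ℝ) : dirichletForm μ (fun a b => s * Q a b) h = s * dirichletForm μ Q h := by
  unfold dirichletForm
  rw [mul_left_comm]
  congr 1
  rw [Finset.mul_sum]
  refine sum_congr rfl fun a _ => ?_
  rw [Finset.mul_sum]
  exact sum_congr rfl fun b _ => by ring

omit [∀ j, Fintype (X j)] in
/-- Entries of `P̃` between split states: a move of coordinate `0` (tail kept) or a move of the tail product
chain (coordinate `0` kept). [cite: LevinPeres2017, §12.4 eqs. (12.22)–(12.23)] -/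
theorem prodKernel_cons_cons (P : ∀ j, X j → X j → ℝ) (w : Fin (d + 1) → ℝ) (u u₂ : X 0)
    (y y₂ : ∀ i : Fin d, X i.succ) :
    prodKernel w P (Fin.cons u y) (Fin.cons u₂ y₂)
      = pairKernel (fun a b => w 0 * P 0 a b) (prodKernel (fun i : Fin d => w i.succ) (fun i : Fin d => P i.succ))
          (u, y) (u₂, y₂) := by
  unfold pairKernel
  rw [prodKernel_apply, Fin.sum_univ_succ, prodKernel_apply]
  congr 1
  · unfold coordKernel
    simp only [Fin.cons_zero, Fin.update_cons_zero]
    by_cases hy : y₂ = y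
    · subst hy
      rw [if_pos rfl, if_pos rfl]
    · rw [if_neg hy, if_neg (fun e => hy (Fin.cons_inj.mp e).2), mul_zero]
  · by_cases hu : u₂ = u
    · subst hu
      rw [if_pos rfl]
      refine sum_congr rfl fun i _ => ?_
      unfold coordKernel
      simp only [Fin.cons_succ, ← Fin.cons_update]
      by_cases hy : y₂ = update y i (y₂ i)
      · rw [if_pos hy, if_pos (by rw [← hy])]
      · rw [if_neg hy, if_neg (fun e => hy (Fin.cons_inj.mp e).2)]
    · rw [if_neg hu]
      refine Finset.sum_eq_zero fun i _ => ?_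
      unfold coordKernel
      simp only [Fin.cons_succ, ← Fin.cons_update]
      rw [if_neg (fun e => hu (Fin.cons_inj.mp e).1), mul_zero]

/-- `𝓔̃(f)` is the Dirichlet form of the two-factor chain (coordinate `0`, tail) read through `Fin.cons`.
[cite: LevinPeres2017, §12.4 eqs. (12.22)–(12.23)] -/
theorem dirichletForm_prodKernel_eq_pair (π : ∀ j, X j → ℝ) (P : ∀ j, X j → X j → ℝ) (w : Fin (d + 1) → ℝ)
    (f : (∀ j, X j) → ℝ) :
    dirichletForm (tensorFun π) (prodKernel w P) f
      = dirichletForm (fun p : X 0 × (∀ i : Fin d, X i.succ) => π 0 p.1 * tensorFun (fun i : Fin d => π i.succ) p.2)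
          (pairKernel (fun a b => w 0 * P 0 a b)
            (prodKernel (fun i : Fin d => w i.succ) (fun i : Fin d => P i.succ)))
          (fun p => f (Fin.cons p.1 p.2)) := by
  unfold dirichletForm
  congr 1
  rw [sum_pi_cons, Fintype.sum_prod_type]
  refine sum_congr rfl fun u _ => sum_congr rfl fun y _ => ?_
  rw [sum_pi_cons, Fintype.sum_prod_type]
  refine sum_congr rfl fun u₂ _ => sum_congr rfl fun y₂ _ => ?_
  rw [tensorFun_cons, prodKernel_cons_cons]

/-- **The Dirichlet form of `P̃` splits off coordinate `0`:**
`𝓔̃(f) = Σ_{x'} π̃'(x')·𝓔_{π_0}(w_0P_0; f(·,x')) + Σ_{x_0} π_0(x_0)·𝓔_{π̃'}(P̃'; f(x_0,·))`, `P̃'` the product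
chain of the remaining coordinates with their weights. [cite: LevinPeres2017, §12.4 eqs. (12.22)–(12.23)
("`P̃ = Σ_j w_j P̃_j`")] -/
theorem dirichletForm_prodKernel_cons (π : ∀ j, X j → ℝ) (P : ∀ j, X j → X j → ℝ) (w : Fin (d + 1) → ℝ)
    (f : (∀ j, X j) → ℝ) :
    dirichletForm (tensorFun π) (prodKernel w P) f
      = ∑ y : (∀ i : Fin d, X i.succ), tensorFun (fun i : Fin d => π i.succ) y
            * dirichletForm (π 0) (fun u v => w 0 * P 0 u v) (fun u => f (Fin.cons u y))
        + ∑ u : X 0, π 0 u * dirichletForm (tensorFun (fun i : Fin d => π i.succ))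
            (prodKernel (fun i : Fin d => w i.succ) (fun i : Fin d => P i.succ)) (fun y => f (Fin.cons u y)) := by
  rw [dirichletForm_prodKernel_eq_pair]
  exact dirichletForm_pairKernel (π 0) _ _ _ (fun u y => f (Fin.cons u y))

end Cons

end Literature.Probability.MarkovChains
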